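import Summits.Ventures.Crystal3D.Theorems.StickyWulffConstantTextureLiminfLineCountGlueLayerRows
import Summits.Ventures.Crystal3D.Theorems.StickyWulffConstantTextureLiminfTexShadowCoverageBarlowDefs
import HarnessLib

/-!
# «LAYER ROWS» (cf-p1 RULINGS (ccix)/(ccx)(A)): the R1-at TARGET PREDICATE `LayerRowsCertifiedAt`, the machine statement `LayerRowsMachine`, and the
# Cover-independent row cut (lane T, crux `TextureLiminfV5`, stmt-Ventures-23912, EDGE-ON flux sliver `stub_edgeOnFlux`; 19480-p1 g16)

HONEST FRAMING. Venture `Summits/Ventures/Crystal3D` (cell `crystal3d-full`), route `route-Ventures-StickyWulffConstant`, helper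
`--supports` the law-v5 crux `TextureLiminfV5` (stmt-Ventures-23912).  DEFINITIONS (the fixed interface between lane G's in-layer row machines R1 —
19480-p2: c-rows = stack walk, h-rows = `hRowStep` p715926 — and the T-side glue p715420) + by-name restatements + the Cover-independent cut.
Nothing about R1 is claimed (it enters as the hypothesis `LayerRowsMachine`); no certificate; rung F-C1 not moved.

* **`LayerRowsCertifiedAt C_w R₀ σ₁ σ₂ L₁ L₂ s₁ s₂`** := VERBATIM the `hF` binder of `bilayerWallAt_of_lineCount_layerRows` (p715420): in every clamped
  cell, `m ≥ 0` and a finite `T ⊇` {rows `kj : ℤ × ℤ` of plate 1 — `{L₁ (layerSite σ₁ L₁ e₃ kj.1 i kj.2) + s₁ : i}`, direction `bestLayerDir L₁ e₃` —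
  with a site of height in `[−R₀−4, −R₀−3]` at lateral `≤ ρ − m`} with `#T + 18mρ ≤ Σ_PAY(12 − deg) + C_w(1+h)ρ` ((ccx)(A): target fixed, accepted by
  the R1 owner 11:37:05Z); **`LayerRowsCertifiedTopAt`** := the `hF` of `…_top` (plate 2, rows toward `−e₃`, window `[h+R₀+3, h+R₀+4]`);
* `bilayerWallAt_of_layerRowsCertifiedAt` / `_top` — p715420 restated through the defs;
* **`LayerRowsMachine Apart C_R1`** := `∀ σ₁ σ₂ L₁ L₂ s₁ s₂, IsHaggSeq σ₁ → IsHaggSeq σ₂ → ⟪L₁ e₃, e₃⟫² < 1/20 → Apart σ₁ σ₂ L₁ L₂ →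
  LayerRowsCertifiedAt C_R1 10 σ₁ σ₂ L₁ L₂ s₁ s₂` — the CONCLUSION of R1 (`barlow_layerRows_inPlane_at : P5Exhaustion → HStarExhaustion → … →
  LayerRowsMachine Apart C_R1` with R1's own apartness predicate `Apart`, e.g. «no row chain frame of `L₁` carries `L₂·Λ₀` or its basal twin»; the named
  facts stay R1's hypotheses, not the cut's); **`LayerRowsMachineTop`** likewise for plate 2;
* **`faultedOnAt_of_layerRowsMachine`** — `LayerRowsMachine Apart C_R1 → BilayerWallFaultedOnAt (fun σ₁ σ₂ L₁ L₂ => ⟪L₁ e₃, e₃⟫² < 1/20 ∧ Apart σ₁ σ₂ L₁ L₂)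
  (13/25) ((C_R1 + 80·19 + 3456 + 1152·11)/2) 10` (every `(13/25)`-admissible table is dominated by half the layer flux: `c0_le_half_layerFlux_of_tilt`);
  `_top` twin; `residualFaultedCoreOnAt_of_layerRowsMachine` (the core-on-regime form) and `bilayerWallFaultedOnAt_mono`.
The companion behind '…EdgeOnRepCover' puts `EdgeOnAt ∧ FluxPairFailAt ∧ Apart` inside this regime by `inner_axis_sq_lt_of_fluxPairFailAt`
('…FluxPairSteerTilt' p714812 + Cover), and names the rows' read class `RowReadAt Apart := EdgeOnAt ∧ FluxPairFailAt ∧ ¬Apart` (measure zero).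
WHAT THIS IS NOT: not R1, not E1h, no certificate; F-C1 not moved.
-/

noncomputable section

open scoped BigOperators InnerProductSpace ENNReal
open MeasureTheory

namespace Summit.Ventures.Crystal3D.Cruxes.TextureLiminf.TexShadow

open Summit.Ventures.Crystal3D Summit.Ventures.Crystal3D.Theorems
open Literature.MathematicalPhysics.StatisticalMechanics (IsHaggSeq)

/-! ## The R1-at target predicates -/

/-- **R1-at's deliverable for plate 1** (verbatim the `hF` binder of `bilayerWallAt_of_lineCount_layerRows`): per clamped cell a margin `m ≥ 0` and a
finite set `T` of row labels `kj : ℤ × ℤ` (row `= {L₁ (layerSite σ₁ L₁ e₃ kj.1 i kj.2) + s₁ : i ∈ ℤ}`) containing every row with a site of height in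
`[−R₀−4, −R₀−3]` at lateral `≤ ρ − m`, and `#T + 18·m·ρ ≤ Σ_{PAY} (12 − deg) + C_w·(1+h)·ρ`. -/
def LayerRowsCertifiedAt (C_w R₀ : ℝ) (σ₁ σ₂ : ℤ → ℤ) (L₁ L₂ : E3 ≃ₗᵢ[ℝ] E3) (s₁ s₂ : E3) : Prop :=
  ∀ h : ℝ, 0 ≤ h → ∀ ρ : ℝ, R₀ ≤ ρ → ∀ X P₁ P₂ : Finset E3,
    (∀ p ∈ X, ∀ q ∈ X, p ≠ q → 1 ≤ dist p q) → P₁ ⊆ X → P₂ ⊆ X \ P₁ → (∀ p ∈ X, p ∈ cyl R₀ h ρ) →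
    (∀ p, p ∈ P₁ ↔ (p ∈ stacking L₁ s₁ σ₁ ∧ -(2 * R₀) ≤ p 2 ∧ p 2 ≤ -R₀ ∧ p 0 ^ 2 + p 1 ^ 2 ≤ ρ ^ 2)) →
    (∀ p, p ∈ P₂ ↔ (p ∈ stacking L₂ s₂ σ₂ ∧ h + R₀ ≤ p 2 ∧ p 2 ≤ h + 2 * R₀ ∧ p 0 ^ 2 + p 1 ^ 2 ≤ ρ ^ 2)) →
    ∃ (m : ℝ) (T : Finset (ℤ × ℤ)), 0 ≤ m ∧
      (∀ kj : ℤ × ℤ, (∃ i : ℤ,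
        -R₀ - 4 ≤ (L₁ (layerSite σ₁ L₁ e₃ kj.1 i kj.2) + s₁) 2 ∧ (L₁ (layerSite σ₁ L₁ e₃ kj.1 i kj.2) + s₁) 2 ≤ -R₀ - 3 ∧
        Real.sqrt ((L₁ (layerSite σ₁ L₁ e₃ kj.1 i kj.2) + s₁) 0 ^ 2 + (L₁ (layerSite σ₁ L₁ e₃ kj.1 i kj.2) + s₁) 1 ^ 2) ≤
          ρ - m) → kj ∈ T) ∧
      (T.card : ℝ) + 18 * m * ρ ≤
        (∑ y ∈ X.filter (fun y => (X.filter fun q => dist y q = 1).card ≠ 12 ∧ -R₀ - 2 ≤ y 2 ∧ y 2 ≤ h + R₀ + 2),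
          ((12 : ℝ) - ((X.filter fun q => dist y q = 1).card : ℝ))) + C_w * (1 + h) * ρ

/-- **R1-at's deliverable for plate 2** (verbatim the `hF` binder of `bilayerWallAt_of_lineCount_layerRows_top`): rows of plate 2 toward `−e₃`,
labels `kj ↦ {L₂ (layerSite σ₂ L₂ (−e₃) kj.1 i kj.2) + s₂}`, window `[h+R₀+3, h+R₀+4]`. -/
def LayerRowsCertifiedTopAt (C_w R₀ : ℝ) (σ₁ σ₂ : ℤ → ℤ) (L₁ L₂ : E3 ≃ₗᵢ[ℝ] E3) (s₁ s₂ : E3) : Prop :=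
  ∀ h : ℝ, 0 ≤ h → ∀ ρ : ℝ, R₀ ≤ ρ → ∀ X P₁ P₂ : Finset E3,
    (∀ p ∈ X, ∀ q ∈ X, p ≠ q → 1 ≤ dist p q) → P₁ ⊆ X → P₂ ⊆ X \ P₁ → (∀ p ∈ X, p ∈ cyl R₀ h ρ) →
    (∀ p, p ∈ P₁ ↔ (p ∈ stacking L₁ s₁ σ₁ ∧ -(2 * R₀) ≤ p 2 ∧ p 2 ≤ -R₀ ∧ p 0 ^ 2 + p 1 ^ 2 ≤ ρ ^ 2)) →
    (∀ p, p ∈ P₂ ↔ (p ∈ stacking L₂ s₂ σ₂ ∧ h + R₀ ≤ p 2 ∧ p 2 ≤ h + 2 * R₀ ∧ p 0 ^ 2 + p 1 ^ 2 ≤ ρ ^ 2)) →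
    ∃ (m : ℝ) (T : Finset (ℤ × ℤ)), 0 ≤ m ∧
      (∀ kj : ℤ × ℤ, (∃ i : ℤ,
        h + R₀ + 3 ≤ (L₂ (layerSite σ₂ L₂ (-e₃) kj.1 i kj.2) + s₂) 2 ∧
        (L₂ (layerSite σ₂ L₂ (-e₃) kj.1 i kj.2) + s₂) 2 ≤ h + R₀ + 4 ∧
        Real.sqrt ((L₂ (layerSite σ₂ L₂ (-e₃) kj.1 i kj.2) + s₂) 0 ^ 2 +
          (L₂ (layerSite σ₂ L₂ (-e₃) kj.1 i kj.2) + s₂) 1 ^ 2) ≤ ρ - m) → kj ∈ T) ∧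
      (T.card : ℝ) + 18 * m * ρ ≤
        (∑ y ∈ X.filter (fun y => (X.filter fun q => dist y q = 1).card ≠ 12 ∧ -R₀ - 2 ≤ y 2 ∧ y 2 ≤ h + R₀ + 2),
          ((12 : ℝ) - ((X.filter fun q => dist y q = 1).card : ℝ))) + C_w * (1 + h) * ρ

/-- **The in-layer row MACHINE statement for plate 1** (the conclusion of R1, `barlow_layerRows_inPlane_at`, with R1's apartness predicate `Apart`
and constant `C_R1`; R1's named facts E1/E1h/… are ITS hypotheses): every Hägg pair whose plate 1 is within `arcsin √(1/20)` of edge-on and apart is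
row-certified at `R₀ = 10`. -/
def LayerRowsMachine (Apart : (ℤ → ℤ) → (ℤ → ℤ) → (E3 ≃ₗᵢ[ℝ] E3) → (E3 ≃ₗᵢ[ℝ] E3) → Prop) (C_R1 : ℝ) : Prop :=
  ∀ (σ₁ σ₂ : ℤ → ℤ) (L₁ L₂ : E3 ≃ₗᵢ[ℝ] E3) (s₁ s₂ : E3), IsHaggSeq σ₁ → IsHaggSeq σ₂ →
    ⟪L₁ e₃, e₃⟫_ℝ ^ 2 < 1 / 20 → Apart σ₁ σ₂ L₁ L₂ → LayerRowsCertifiedAt C_R1 10 σ₁ σ₂ L₁ L₂ s₁ s₂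

/-- **The in-layer row MACHINE statement for plate 2** (rows toward `−e₃`). -/
def LayerRowsMachineTop (Apart : (ℤ → ℤ) → (ℤ → ℤ) → (E3 ≃ₗᵢ[ℝ] E3) → (E3 ≃ₗᵢ[ℝ] E3) → Prop) (C_R1 : ℝ) : Prop :=
  ∀ (σ₁ σ₂ : ℤ → ℤ) (L₁ L₂ : E3 ≃ₗᵢ[ℝ] E3) (s₁ s₂ : E3), IsHaggSeq σ₁ → IsHaggSeq σ₂ →
    ⟪L₂ e₃, e₃⟫_ℝ ^ 2 < 1 / 20 → Apart σ₁ σ₂ L₁ L₂ → LayerRowsCertifiedTopAt C_R1 10 σ₁ σ₂ L₁ L₂ s₁ s₂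

/-! ## By-name restatements of the T-side glue (p715420) -/

/-- **Row certificate ⇒ covered cell (plate 1)**, by name: `bilayerWallAt_of_lineCount_layerRows` through `LayerRowsCertifiedAt`. -/
theorem bilayerWallAt_of_layerRowsCertifiedAt {σ₁ σ₂ : ℤ → ℤ} (hσ₁ : IsHaggSeq σ₁) (hσ₂ : IsHaggSeq σ₂)
    (L₁ L₂ : E3 ≃ₗᵢ[ℝ] E3) (s₁ s₂ : E3) (τ₀ R₀ C_w : ℝ) (hτ₀ : 1 / 4 ≤ τ₀) (hR₀ : 3 ≤ R₀)
    (c : ℤ → ℤ → ℝ) (hc0 : ∀ i j, 0 ≤ c i j) (hdom : ∀ i j, c i j ≤ layerFlux τ₀ L₁ e₃ / 2)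
    (hF : LayerRowsCertifiedAt C_w R₀ σ₁ σ₂ L₁ L₂ s₁ s₂) :
    BilayerWallAt ((C_w + 80 * (R₀ + 9) + 3456 + 1152 * (R₀ + 1)) / 2) R₀ σ₁ σ₂ L₁ L₂ s₁ s₂ c :=
  bilayerWallAt_of_lineCount_layerRows hσ₁ hσ₂ L₁ L₂ s₁ s₂ τ₀ R₀ C_w hτ₀ hR₀ c hc0 hdom hF

/-- **Row certificate ⇒ covered cell (plate 2)**, by name. -/
theorem bilayerWallAt_of_layerRowsCertifiedTopAt {σ₁ σ₂ : ℤ → ℤ} (hσ₁ : IsHaggSeq σ₁) (hσ₂ : IsHaggSeq σ₂)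
    (L₁ L₂ : E3 ≃ₗᵢ[ℝ] E3) (s₁ s₂ : E3) (τ₀ R₀ C_w : ℝ) (hτ₀ : 1 / 4 ≤ τ₀) (hR₀ : 3 ≤ R₀)
    (c : ℤ → ℤ → ℝ) (hc0 : ∀ i j, 0 ≤ c i j) (hdom : ∀ i j, c i j ≤ layerFlux τ₀ L₂ (-e₃) / 2)
    (hF : LayerRowsCertifiedTopAt C_w R₀ σ₁ σ₂ L₁ L₂ s₁ s₂) :
    BilayerWallAt ((C_w + 80 * (R₀ + 9) + 3456 + 1152 * (R₀ + 1)) / 2) R₀ σ₁ σ₂ L₁ L₂ s₁ s₂ c :=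
  bilayerWallAt_of_lineCount_layerRows_top hσ₁ hσ₂ L₁ L₂ s₁ s₂ τ₀ R₀ C_w hτ₀ hR₀ c hc0 hdom hF

/-! ## The Cover-independent row cut -/

/-- The on-`Reg` cell law restricts along implications of regimes. -/
theorem bilayerWallFaultedOnAt_mono {Reg Reg' : (ℤ → ℤ) → (ℤ → ℤ) → (E3 ≃ₗᵢ[ℝ] E3) → (E3 ≃ₗᵢ[ℝ] E3) → Prop}
    (hle : ∀ σ₁ σ₂ L₁ L₂, Reg' σ₁ σ₂ L₁ L₂ → Reg σ₁ σ₂ L₁ L₂) {c₀ C R₀ : ℝ} (h : BilayerWallFaultedOnAt Reg c₀ C R₀) :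
    BilayerWallFaultedOnAt Reg' c₀ C R₀ :=
  fun σ₁ σ₂ hσ₁ hσ₂ hf L₁ L₂ s₁ s₂ A₁ A₂ u₁ u₂ hA₁ hA₂ hreg c m hadm =>
    h σ₁ σ₂ hσ₁ hσ₂ hf L₁ L₂ s₁ s₂ A₁ A₂ u₁ u₂ hA₁ hA₂ (hle σ₁ σ₂ L₁ L₂ hreg) c m hadm

/-- **THE ROW CUT (plate 1), Cover-independent form**: the machine statement gives the whole cell law at cap `13/25` on the regime
`⟪L₁ e₃, e₃⟫² < 1/20 ∧ Apart σ₁ σ₂ L₁ L₂`, constants `((C_R1 + 80·19 + 3456 + 1152·11)/2, 10)` — every `(13/25)`-admissible table is dominated by half the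
layer flux (`c0_le_half_layerFlux_of_tilt`, `1/20 ≤ 1/4`). -/
theorem faultedOnAt_of_layerRowsMachine {Apart : (ℤ → ℤ) → (ℤ → ℤ) → (E3 ≃ₗᵢ[ℝ] E3) → (E3 ≃ₗᵢ[ℝ] E3) → Prop} {C_R1 : ℝ}
    (hR1 : LayerRowsMachine Apart C_R1) :
    BilayerWallFaultedOnAt (fun σ₁ σ₂ L₁ L₂ => ⟪L₁ e₃, e₃⟫_ℝ ^ 2 < 1 / 20 ∧ Apart σ₁ σ₂ L₁ L₂) (13 / 25)
      ((C_R1 + 80 * (10 + 9) + 3456 + 1152 * (10 + 1)) / 2) 10 := by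
  intro σ₁ σ₂ hσ₁ hσ₂ _ L₁ L₂ s₁ s₂ A₁ A₂ u₁ u₂ _ _ hreg c m hadm
  have he₃ : ‖(e₃ : E3)‖ = 1 := by rw [e₃, PiLp.norm_single, norm_one]
  obtain ⟨htilt, hapart⟩ := hreg
  have hdom : ∀ i j, c i j ≤ layerFlux (1 / 4) L₁ e₃ / 2 := fun i j =>
    (hadm.2.1 i j).trans (c0_le_half_layerFlux_of_tilt L₁ he₃ (by linarith) (by norm_num))
  exact bilayerWallAt_of_lineCount_layerRows hσ₁ hσ₂ L₁ L₂ s₁ s₂ (1 / 4) 10 C_R1 le_rfl (by norm_num) c hadm.1 hdom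
    (hR1 σ₁ σ₂ L₁ L₂ s₁ s₂ hσ₁ hσ₂ htilt hapart)

/-- **THE ROW CUT (plate 2), Cover-independent form.** -/
theorem faultedOnAt_of_layerRowsMachineTop {Apart : (ℤ → ℤ) → (ℤ → ℤ) → (E3 ≃ₗᵢ[ℝ] E3) → (E3 ≃ₗᵢ[ℝ] E3) → Prop} {C_R1 : ℝ}
    (hR1 : LayerRowsMachineTop Apart C_R1) :
    BilayerWallFaultedOnAt (fun σ₁ σ₂ L₁ L₂ => ⟪L₂ e₃, e₃⟫_ℝ ^ 2 < 1 / 20 ∧ Apart σ₁ σ₂ L₁ L₂) (13 / 25)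
      ((C_R1 + 80 * (10 + 9) + 3456 + 1152 * (10 + 1)) / 2) 10 := by
  intro σ₁ σ₂ hσ₁ hσ₂ _ L₁ L₂ s₁ s₂ A₁ A₂ u₁ u₂ _ _ hreg c m hadm
  have he₃ : ‖(e₃ : E3)‖ = 1 := by rw [e₃, PiLp.norm_single, norm_one]
  have hne₃ : ‖(-e₃ : E3)‖ = 1 := by rw [norm_neg, he₃]
  obtain ⟨htilt, hapart⟩ := hreg
  have htilt' : ⟪L₂ e₃, -e₃⟫_ℝ ^ 2 ≤ 1 / 4 := by rw [inner_neg_right, neg_sq]; linarith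
  have hdom : ∀ i j, c i j ≤ layerFlux (1 / 4) L₂ (-e₃) / 2 := fun i j =>
    (hadm.2.1 i j).trans (c0_le_half_layerFlux_of_tilt L₂ hne₃ htilt' (by norm_num))
  exact bilayerWallAt_of_lineCount_layerRows_top hσ₁ hσ₂ L₁ L₂ s₁ s₂ (1 / 4) 10 C_R1 le_rfl (by norm_num) c hadm.1 hdom
    (hR1 σ₁ σ₂ L₁ L₂ s₁ s₂ hσ₁ hσ₂ htilt hapart)

/-- **The core-on-regime form** (the shape of the registered stub, plate 1): `∃ C`, the residual core on `⟪L₁ e₃, e₃⟫² < 1/20 ∧ Apart`. -/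
theorem residualFaultedCoreOnAt_of_layerRowsMachine {Apart : (ℤ → ℤ) → (ℤ → ℤ) → (E3 ≃ₗᵢ[ℝ] E3) → (E3 ≃ₗᵢ[ℝ] E3) → Prop} {C_R1 : ℝ}
    (hR1 : LayerRowsMachine Apart C_R1) :
    ∃ C : ℝ, BilayerWallResidualFaultedCoreOnAt (fun σ₁ σ₂ L₁ L₂ => ⟪L₁ e₃, e₃⟫_ℝ ^ 2 < 1 / 20 ∧ Apart σ₁ σ₂ L₁ L₂) (13 / 25) C 10 :=
  ⟨_, residualFaultedCoreOnAt_of_faultedOnAt (faultedOnAt_of_layerRowsMachine hR1)⟩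

end Summit.Ventures.Crystal3D.Cruxes.TextureLiminf.TexShadow

end
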